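import Summits.BirchSwinnertonDyer.BirchSwinnertonDyer.Theorems.AlignedTransportAtTwoMainConjectureTransportAlignedAtTwoKilfordPlaneTransport
import Summits.BirchSwinnertonDyer.BirchSwinnertonDyer.Theorems.AlignedTransportAtTwoMainConjectureTransportAlignedAtTwoDeltaPosAlignmentComplex
import HarnessLib

/-!
# Crux C1 `MainConjectureTransportAlignedAtTwo` (stmt-BirchSwinnertonDyer-22296), line `birth`, residual (R2) `stub_lamLawKilford`:
# MOD-2 PARITY AGREEMENT OF THE TWO PARAMETRISATION MAPS FORCES NESTED HALF-CLASS KERNELS — the converse of the line's transport, so the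
# same-plane hypothesis (SP) `hker` is EQUIVALENT to «the two mod-2 symbols agree on `H₁(X₀(L);ℤ)`» (width seat att-p4 g15; `--supports 22296`)

THEOREMS ONLY (no `def`, no named fact, no `sorry`). BSD is not proved by this; C1 is not closed by this; `stub_lamLawKilford` is NOT discharged by this.

WHY. The landed (R2) capstones (att-p4 g14 p672789/p673398, att-p3 g15 p674542/p675259) derive, from the same-plane hypothesis
`hker : ∀ x ∈ Λ_L, Φ₁ [x/2] = 0 ↔ Φ₂ [x/2] = 0` (+ `Γ_ℚ`-equivariance + alignment at `∞`), the agreement of the two mod-`2` plus symbols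
`h₁ = h₂` on `Λ_L = H₁(X₀(L);ℤ)` — by the (K2)/(K2′)/(K2⁻) dictionaries `hᵢ(x)` is even iff `Φᵢ [x/2] ∈ {O, Tᵢ*}` with `Tᵢ*` the real-structure
`2`-torsion point — and feed it to the engine. The crux workfile `KILFORD-PLANE-att-p4-g14.md` §2 asserted the CONVERSE on paper («given alignment at
`∞`: `h₁ = h₂` ⟺ (SP)», by irreducibility of `ρ̄`). This file proves it in the kernel in a sharper form that needs NEITHER irreducibility NOR alignment
at `∞` NOR any property of the marker on the first curve: if for every `x ∈ Λ_L`
`(Φ₁ [x/2] = O ∨ Φ₁ [x/2] = Q₁) ↔ (Φ₂ [x/2] = O ∨ Φ₂ [x/2] = ι T₂)` with `Q₁ ∈ W₁(ℂ)` ARBITRARY and `T₂ ∈ W₂[2](ℚ̄) ∖ {O}`, then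
`Φ₁ [x/2] = O ⟹ Φ₂ [x/2] = O` on `Λ_L` — because a half-class `x` with `Φ₁ [x/2] = O`, `Φ₂ [x/2] = ι T₂` has `Γ_ℚ`-translates `σx` with `Φ₁ [σx/2] = O`
and `Φ₂ [σx/2] = ι (σT₂)`, so the hypothesis at `σx` forces `σ T₂ = T₂` for all `σ`: a RATIONAL point of order `2` on `W₂`, excluded by
`∀ x, ¬ HasRationalTwoTorsionX W₂ x`. Consequences:

* `ker_le_of_parity_iff` (one inclusion, hypotheses on `W₂` only), `ker_iff_of_parity_iff` (both: (SP) from parity agreement);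
* so, for the planners: typing the open (R2) input as «aligned ⟹ same plane (hker)» or as «aligned ⟹ the mod-2 depleted plus symbols agree on all of
  `H₁(X₀(N′);ℤ)`» is the SAME statement in the kernel (given the landed dictionaries); the census (-imc dimc9 P12, 2 596/2 596) measures the latter on the
  Mazur–Tate layer classes.

References: Silverman AEC III.§7 (rational torsion and Galois-fixed points); Darmon–Diamond–Taylor 1995 §1.5, §1.7 (the `ℚ`-structure of `J₀(L)`).
-/

noncomputable section

-- justification: the `Summit.BirchSwinnertonDyer.BirchSwinnertonDyer.…` path repeats a component (route-file convention)
set_option linter.dupNamespace false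
set_option autoImplicit false

open scoped MatrixGroups ModularForm NumberField Classical
open CongruenceSubgroup Complex WeierstrassCurve IsDedekindDomain Polynomial Module
open Literature.NumberTheory.EllipticCurves Literature.NumberTheory.EllipticCurves.ModularForms
open Literature.NumberTheory.EllipticCurves.Greenberg1999
open Summit.BirchSwinnertonDyer.Rank1Residual.F1Sign2
open Summit.BirchSwinnertonDyer.BirchSwinnertonDyer.Theorems.ThetaLayerLambdaCongruenceAtTwo
open Summit.BirchSwinnertonDyer.BirchSwinnertonDyer.Theorems.AlignedTransportAtTwoRhombicOfNegDisc hiding natCard_geomTorsion_two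
open Summit.BirchSwinnertonDyer.BirchSwinnertonDyer.Theorems.AlignedTransportAtTwoDeltaPosAlignmentComplex
open Summit.BirchSwinnertonDyer.BirchSwinnertonDyer.Theorems.AlignedTransportAtTwoDeltaPosJacobian

namespace Summit.BirchSwinnertonDyer.BirchSwinnertonDyer.Theorems.AlignedTransportAtTwoKilfordPlaneParity

section Parity

variable {L : ℕ} [NeZero L] (ι : AlgebraicClosure ℚ →+* ℂ)

/-- **Mod-2 parity agreement forces the kernel inclusion `ker θ₁ ≤ ker θ₂` on half-classes.** Two additive maps `Φᵢ : J₀(L) → Wᵢ(ℂ)`,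
`Γ_ℚ`-equivariant on torsion for a common abstract action `gal` (`hgalᵢ`); a marker `Q₁ ∈ W₁(ℂ)` (ANY point) and a non-zero `T₂ ∈ W₂[2](ℚ̄)`; `W₂` without a
rational `2`-torsion abscissa. If for every `x ∈ Λ_L` the two «parities» agree — `Φ₁ [x/2] ∈ {O, Q₁} ↔ Φ₂ [x/2] ∈ {O, ι T₂}` — then
`Φ₁ [x/2] = O ⟹ Φ₂ [x/2] = O` on `Λ_L`. No irreducibility, no sign of `Δ`, no alignment at `∞`, no Hecke algebra.
[cite: SilvermanAEC2009, III.§7] [cite: DarmonDiamondTaylor1995, §1.5 and §1.7] -/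
theorem ker_le_of_parity_iff
    {W₁ W₂ : WeierstrassCurve ℚ} [W₁.IsElliptic] [W₂.IsElliptic]
    (ht₂ : ∀ x : ℚ, ¬ HasRationalTwoTorsionX W₂ x)
    (Φ₁ : J0 L →+ (W₁.baseChange ℂ).toAffine.Point) (Φ₂ : J0 L →+ (W₂.baseChange ℂ).toAffine.Point)
    (gal : Field.absoluteGaloisGroup ℚ → (J0.tors L →+ J0.tors L))
    (hgal₁ : ∀ (σ : Field.absoluteGaloisGroup ℚ) (y : J0.tors L) (P : W₁.geomPoints),
      Φ₁ (y : J0 L) = W₁.geomPointsToComplex ι P → Φ₁ ((gal σ y : J0.tors L) : J0 L) = W₁.geomPointsToComplex ι (σ • P))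
    (hgal₂ : ∀ (σ : Field.absoluteGaloisGroup ℚ) (y : J0.tors L) (P : W₂.geomPoints),
      Φ₂ (y : J0 L) = W₂.geomPointsToComplex ι P → Φ₂ ((gal σ y : J0.tors L) : J0 L) = W₂.geomPointsToComplex ι (σ • P))
    (Q₁ : (W₁.baseChange ℂ).toAffine.Point) {T₂ : geomTorsion W₂ (2 : ℤ)} (hT₂ : T₂ ≠ 0)
    (hpar : ∀ x ∈ periodHomology L,
      (Φ₁ (Submodule.Quotient.mk ((2 : ℂ)⁻¹ • x)) = 0 ∨ Φ₁ (Submodule.Quotient.mk ((2 : ℂ)⁻¹ • x)) = Q₁) ↔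
        (Φ₂ (Submodule.Quotient.mk ((2 : ℂ)⁻¹ • x)) = 0 ∨
          Φ₂ (Submodule.Quotient.mk ((2 : ℂ)⁻¹ • x)) = W₂.geomPointsToComplex ι (T₂ : W₂.geomPoints))) :
    ∀ x ∈ periodHomology L,
      Φ₁ (Submodule.Quotient.mk ((2 : ℂ)⁻¹ • x)) = 0 → Φ₂ (Submodule.Quotient.mk ((2 : ℂ)⁻¹ • x)) = 0 := by
  intro x hx h₁
  by_contra h₂
  -- the hypothesis at `x`: `Φ₂ [x/2] = ι T₂`
  have h₂T : Φ₂ (Submodule.Quotient.mk ((2 : ℂ)⁻¹ • x)) = W₂.geomPointsToComplex ι (T₂ : W₂.geomPoints) :=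
    ((hpar x hx).mp (Or.inl h₁)).resolve_left h₂
  -- `[x/2]` is a torsion point of `J₀(L)`
  have htors : (Submodule.Quotient.mk ((2 : ℂ)⁻¹ • x) : J0 L) ∈ J0.tors L := by
    rw [J0.mem_tors_iff, isOfFinAddOrder_iff_nsmul_eq_zero]
    exact ⟨2, two_pos, by rw [two_nsmul]; exact half_add_half_eq_zero hx⟩
  -- `T₂` is `Γ_ℚ`-fixed: transport the hypothesis to the `σ`-translate of the half-class
  have hfix : ∀ σ : Field.absoluteGaloisGroup ℚ, σ • (T₂ : W₂.geomPoints) = (T₂ : W₂.geomPoints) := by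
    intro σ
    set t : J0.tors L := gal σ ⟨Submodule.Quotient.mk ((2 : ℂ)⁻¹ • x), htors⟩ with ht
    have htt : (t : J0 L) + (t : J0 L) = 0 := by
      rw [← Submodule.coe_add, ht, ← map_add]
      have h0 : (⟨Submodule.Quotient.mk ((2 : ℂ)⁻¹ • x), htors⟩ : J0.tors L) + ⟨Submodule.Quotient.mk ((2 : ℂ)⁻¹ • x), htors⟩ = 0 :=
        Subtype.ext (half_add_half_eq_zero hx)
      rw [h0, map_zero, Submodule.coe_zero]
    obtain ⟨x', hx', hx'eq⟩ := exists_half_eq htt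
    -- `Φ₁ [x'/2] = ι (σ • O) = O`
    have h₁' : Φ₁ (Submodule.Quotient.mk ((2 : ℂ)⁻¹ • x')) = 0 := by
      have h := hgal₁ σ ⟨Submodule.Quotient.mk ((2 : ℂ)⁻¹ • x), htors⟩ 0 (by rw [map_zero]; exact h₁)
      rw [smul_zero, map_zero] at h
      rw [hx'eq]
      exact h
    -- `Φ₂ [x'/2] = ι (σ • T₂)`
    have h₂' : Φ₂ (Submodule.Quotient.mk ((2 : ℂ)⁻¹ • x')) = W₂.geomPointsToComplex ι (σ • (T₂ : W₂.geomPoints)) := by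
      rw [hx'eq]
      exact hgal₂ σ ⟨Submodule.Quotient.mk ((2 : ℂ)⁻¹ • x), htors⟩ (T₂ : W₂.geomPoints) h₂T
    rcases (hpar x' hx').mp (Or.inl h₁') with h0 | hT
    · -- `ι (σ • T₂) = O` is impossible
      exfalso
      rw [h₂'] at h0
      have hσ0 : σ • (T₂ : W₂.geomPoints) = 0 := geomPointsToComplex_injective W₂ ι (by rw [h0, map_zero])
      rw [← AddSubgroup.torsionBy.coe_smul, ZeroMemClass.coe_eq_zero, smul_eq_zero_iff_eq] at hσ0
      exact hT₂ hσ0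
    · rw [h₂'] at hT
      exact geomPointsToComplex_injective W₂ ι hT
  -- a `Γ_ℚ`-fixed point of order `2` on `W₂` is rational: excluded
  have h1 : ratTwoTorsionCard W₂ = 1 := ratTwoTorsionCard_eq_one_of_forall_not_hasRationalTwoTorsionX W₂ ht₂
  have hQ2 : (2 : ℤ) • (T₂ : W₂.geomPoints) = 0 := (mem_geomTorsion_iff W₂ 2 _).mp T₂.2
  exact hT₂ (Subtype.ext (eq_zero_of_fixed_of_two_smul_eq_zero_of_ratTwoTorsionCard_eq_one W₂ h1 hQ2 hfix))

/-- **(SP) FROM PARITY AGREEMENT.** Same setting on BOTH sides (`Wᵢ` without rational `2`-torsion abscissa, non-zero markers `Tᵢ ∈ Wᵢ[2](ℚ̄)`): if for every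
`x ∈ Λ_L` `Φ₁ [x/2] ∈ {O, ι T₁} ↔ Φ₂ [x/2] ∈ {O, ι T₂}`, then the two half-class kernels COINCIDE: `Φ₁ [x/2] = O ↔ Φ₂ [x/2] = O` on `Λ_L` — the
hypothesis `hker` of `…KilfordCopyTransportLevel.half_transport_of_abstract_of_ker_iff` / `…KilfordCopyCongruenceLevel.lamLaw_of_abstractForms_of_ker_iff`,
and (one direction) of `…KilfordPlaneTransport.half_transport_of_kernel_le`. With the (K2′)/(K2⁻′) dictionaries (`…DeltaPosFunctionalDepleted`,
`…KilfordCopyNegDiscDepleted`: `Even nᵢ(x) ↔ Φᵢ [x/2] ∈ {O, ι Tᵢ*}`) this says: agreement of the two mod-`2` depleted plus symbols on `H₁(X₀(L);ℤ)` ⟹ (SP).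
[cite: SilvermanAEC2009, III.§7] [cite: DarmonDiamondTaylor1995, §1.5 and §1.7] -/
theorem ker_iff_of_parity_iff
    {W₁ W₂ : WeierstrassCurve ℚ} [W₁.IsElliptic] [W₂.IsElliptic]
    (ht₁ : ∀ x : ℚ, ¬ HasRationalTwoTorsionX W₁ x) (ht₂ : ∀ x : ℚ, ¬ HasRationalTwoTorsionX W₂ x)
    (Φ₁ : J0 L →+ (W₁.baseChange ℂ).toAffine.Point) (Φ₂ : J0 L →+ (W₂.baseChange ℂ).toAffine.Point)
    (gal : Field.absoluteGaloisGroup ℚ → (J0.tors L →+ J0.tors L))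
    (hgal₁ : ∀ (σ : Field.absoluteGaloisGroup ℚ) (y : J0.tors L) (P : W₁.geomPoints),
      Φ₁ (y : J0 L) = W₁.geomPointsToComplex ι P → Φ₁ ((gal σ y : J0.tors L) : J0 L) = W₁.geomPointsToComplex ι (σ • P))
    (hgal₂ : ∀ (σ : Field.absoluteGaloisGroup ℚ) (y : J0.tors L) (P : W₂.geomPoints),
      Φ₂ (y : J0 L) = W₂.geomPointsToComplex ι P → Φ₂ ((gal σ y : J0.tors L) : J0 L) = W₂.geomPointsToComplex ι (σ • P))
    {T₁ : geomTorsion W₁ (2 : ℤ)} (hT₁ : T₁ ≠ 0) {T₂ : geomTorsion W₂ (2 : ℤ)} (hT₂ : T₂ ≠ 0)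
    (hpar : ∀ x ∈ periodHomology L,
      (Φ₁ (Submodule.Quotient.mk ((2 : ℂ)⁻¹ • x)) = 0 ∨
          Φ₁ (Submodule.Quotient.mk ((2 : ℂ)⁻¹ • x)) = W₁.geomPointsToComplex ι (T₁ : W₁.geomPoints)) ↔
        (Φ₂ (Submodule.Quotient.mk ((2 : ℂ)⁻¹ • x)) = 0 ∨
          Φ₂ (Submodule.Quotient.mk ((2 : ℂ)⁻¹ • x)) = W₂.geomPointsToComplex ι (T₂ : W₂.geomPoints))) :
    ∀ x ∈ periodHomology L,
      Φ₁ (Submodule.Quotient.mk ((2 : ℂ)⁻¹ • x)) = 0 ↔ Φ₂ (Submodule.Quotient.mk ((2 : ℂ)⁻¹ • x)) = 0 :=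
  fun x hx ↦
    ⟨ker_le_of_parity_iff ι ht₂ Φ₁ Φ₂ gal hgal₁ hgal₂ (W₁.geomPointsToComplex ι (T₁ : W₁.geomPoints)) hT₂ hpar x hx,
      ker_le_of_parity_iff ι ht₁ Φ₂ Φ₁ gal hgal₂ hgal₁ (W₂.geomPointsToComplex ι (T₂ : W₂.geomPoints)) hT₁
        (fun y hy ↦ (hpar y hy).symm) x hx⟩

end Parity

end Summit.BirchSwinnertonDyer.BirchSwinnertonDyer.Theorems.AlignedTransportAtTwoKilfordPlaneParity

end
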